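import Literature.AlgebraicGeometry.Morphisms.SmoothConnectedFibreLocusOpen
import Literature.AlgebraicGeometry.Morphisms.SteinFactorizationLocalCriterion
import Literature.AlgebraicGeometry.Motives.OpenSubfunctorRepresentable
import Mathlib.AlgebraicGeometry.Morphisms.SmoothFiber
import Mathlib.AlgebraicGeometry.Morphisms.LocalFlatDescent
import Mathlib.FieldTheory.IsAlgClosed.AlgebraicClosure
import HarnessLib

/-!
# The open subscheme of smooth geometrically connected fibres represents «the base change is smooth with
# geometrically connected fibres» (MFK Prop. 7.3, step (I), represents-form)

Topic `Literature/AlgebraicGeometry/Morphisms`; theorems only (no definition, no named fact, no instance, no notation,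
no `sorry`).  Cell hodgecm-mathlib, F-DAG F-6 step (I), the REPRESENTS-form asked for by the F-6 locus-tower census
(`B-provers/B-p02/g14/CENSUS-F6-LocusTower.B-p02g14.md`, row (I)): ★ `Morphisms/SmoothConnectedFibreLocusOpen` gives the
SET-shape statement «`U₁ := {s | X_s smooth and geometrically connected}` is open» for `p : X → S` proper and flat over a
locally noetherian `S`; here we prove that the open subscheme `U₁ ↪ S` REPRESENTS the sub-functor of `Hom(−, S)`
`T ↦ {g : T → S | X ×_S T → T is smooth with geometrically connected fibres}`, i.e. for every base change square
`X_T → T` of `p` along `g : T → S`,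
`(∃! g', g' ≫ U₁.ι = g) ↔ Smooth (X_T → T) ∧ GeometricallyConnected (X_T → T)`
([MumfordFogartyKirwan1994] Ch. 7 §2, Prop. 7.3, proof, step (I): «it is clear that `U₁` is a subfunctor of `Hilb` which
is represented by an open subset» — the (γ)-shape `∃ H j, IsOpenImmersion j ∧ ∀ b, (∃! v, v ≫ j = b) ↔ P(b)` the
tower assembler composes).  HC_CM is proved only modulo the 7 printed citations until rung 0 closes; nothing here bears
on a summit statement.

* §1 **fibre properties of a base change are read at the image point** (any universe, any cartesian square
  `h : IsPullback fst snd f g`, `y : Y`): the fibre of `snd` at `y` is the base change of the fibre of `f` at `g y`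
  along the field extension `Spec κ(y) → Spec κ(g y)` (Mathlib `isPullback_fiberToSpecResidueField_of_isPullback`), and
  both smoothness (fpqc descent, Mathlib `DescendsAlong @Smooth (@Surjective ⊓ @Flat ⊓ @QuasiCompact)`) and geometric
  connectedness (★ `SteinFibre.geometricallyConnected_of_geometricallyConnected_baseChange`) descend along field
  extensions: `iff_of_isPullback_specMap_ofHom`, `geometricallyConnected_iff_of_isPullback_specMap_ofHom`,
  `iff_fiberToSpecResidueField_of_isPullback`, `smooth_fiberToSpecResidueField_iff_of_isPullback`,
  `geometricallyConnected_fiberToSpecResidueField_iff_of_isPullback`; and the geometric-points criterion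
  `geometricallyConnected_iff_forall_isAlgClosed` over an arbitrary base.
* §2 **range criterion** (any universe, no properness): `Set.range g ⊆ U₁(f)` iff every fibre of `snd` is smooth and
  geometrically connected (`range_subset_setOf_iff_forall_fiber`) iff — for `f` flat and locally of finite presentation —
  `Smooth snd ∧ GeometricallyConnected snd` (`range_subset_setOf_iff_smooth_and_geometricallyConnected`, Mathlib
  `Smooth.of_smooth_fiberToSpecResidueField` + `GeometricallyConnected.iff_geometricallyConnected_fiber`) iff the base
  change to every GEOMETRIC point of `Y` is smooth and connected (`range_subset_setOf_iff_forall_isAlgClosed`, MFK's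
  wording «smooth with connected geometric fibres»); hence the universal property of ANY open `U` with carrier `U₁(f)`
  (`existsUnique_comp_ι_iff_smooth_and_geometricallyConnected`, ★ A10 `existsUnique_comp_opensι_eq_iff_range_subset`).
* §3 **the locus** (`Scheme.{0}`, `p` proper flat, `S` locally noetherian, binder convention of ★
  `Modules/CompleteLinearSystemLocus`): `exists_opens_forall_existsUnique_comp_ι_iff_smooth_and_geometricallyConnected`,
  the (γ)-shape `exists_isOpenImmersion_forall_existsUnique_comp_eq_iff_smooth_and_geometricallyConnected`, and the
  canonical-pullback / fibrewise / geometric-point variants.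

## References
* D. Mumford, J. Fogarty, F. Kirwan, *Geometric Invariant Theory*, 3rd ed. (1994), Ch. 7 §2, Prop. 7.3, proof, step (I)
  (pp. 132–133). [MumfordFogartyKirwan1994]
* A. Grothendieck, EGA IV₄ (Publ. Math. IHÉS 32, 1967), Thm. 17.5.1, Prop. 17.7.4. [EGAIV4]
* The Stacks Project, Tag 02VL (smoothness is fpqc local on the base), Tag 01V8 (flat + smooth fibres ⇒ smooth).
  [StacksProject]
* U. Görtz, T. Wedhorn, *Algebraic Geometry I: Schemes*, 2nd ed. (2020), Prop. 5.53 and Cor. 5.54 (pp. 139–140)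
  (geometric connectedness and field extensions), Thm. 8.9 (p. 212) (open subfunctors). [GortzWedhorn2020]
-/

noncomputable section

set_option backward.isDefEq.respectTransparency false

open CategoryTheory CategoryTheory.Limits Opposite TopologicalSpace AlgebraicGeometry

universe u

namespace Literature.AlgebraicGeometry.Morphisms

/-! ## §1 Descent of fibre properties along field extensions; fibres of a base change -/

section FieldExtension

variable {k l : Type u} [Field k] [Field l] (φ : k →+* l)

/-- `Spec l → Spec k` is surjective for a homomorphism of fields (both spectra are points). [folklore] -/
private theorem surjective_specMap_ofHom_field : Surjective (Spec.map (CommRingCat.ofHom φ)) := by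
  haveI : Subsingleton ↥(Spec (CommRingCat.of k)) := inferInstanceAs (Subsingleton (PrimeSpectrum k))
  exact ⟨fun x ↦ ⟨(default : ↥(Spec (CommRingCat.of l))), Subsingleton.elim _ _⟩⟩

/-- `Spec l → Spec k` is flat for a homomorphism of fields (`l` is a free `k`-module). [folklore] -/
private theorem flat_specMap_ofHom_field : Flat (Spec.map (CommRingCat.ofHom φ)) := by
  letI := φ.toAlgebra
  rw [HasRingHomProperty.Spec_iff (P := @Flat)]
  change Module.Flat k l
  infer_instance

/-- **`Spec l → Spec k` is an fpqc cover** for a homomorphism of fields `φ : k → l`: it is surjective, flat and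
quasi-compact. [cite: StacksProject, Tag 02VL] -/
theorem surjective_flat_quasiCompact_specMap_ofHom :
    (@Surjective ⊓ @Flat ⊓ @QuasiCompact : MorphismProperty Scheme.{u}) (Spec.map (CommRingCat.ofHom φ)) :=
  ⟨⟨surjective_specMap_ofHom_field φ, flat_specMap_ofHom_field φ⟩, inferInstance⟩

variable {T T' : Scheme.{u}} {g : T ⟶ Spec (.of k)} {g' : T' ⟶ Spec (.of l)} {q : T' ⟶ T}

/-- **A base-change-stable fpqc-descending property of a `k`-morphism is insensitive to field extension**
([EGAIV4] Prop. 17.7.4 for smoothness; [StacksProject] Tag 02VL): for a cartesian square `T' = T ⊗_k l` over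
`Spec l → Spec k`, `P (T' → Spec l) ↔ P (T → Spec k)`. [cite: EGAIV4, Prop. 17.7.4] [cite: StacksProject, Tag 02VL] -/
theorem iff_of_isPullback_specMap_ofHom (P : MorphismProperty Scheme.{u}) [P.IsStableUnderBaseChange]
    [P.DescendsAlong (@Surjective ⊓ @Flat ⊓ @QuasiCompact)]
    (H : IsPullback q g' g (Spec.map (CommRingCat.ofHom φ))) : P g' ↔ P g :=
  MorphismProperty.iff_of_isPullback H.flip (surjective_flat_quasiCompact_specMap_ofHom φ)

/-- **Smoothness of a `k`-scheme is insensitive to field extension** (cartesian-square form).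
[cite: EGAIV4, Prop. 17.7.4] [cite: StacksProject, Tag 02VL] -/
theorem smooth_iff_of_isPullback_specMap_ofHom (H : IsPullback q g' g (Spec.map (CommRingCat.ofHom φ))) :
    Smooth g' ↔ Smooth g :=
  iff_of_isPullback_specMap_ofHom φ @Smooth H

/-- **Geometric connectedness of a `k`-scheme is insensitive to field extension** (cartesian-square form; the descent
direction is ★ `SteinFibre.geometricallyConnected_of_geometricallyConnected_baseChange`).
[cite: GortzWedhorn2020, Prop. 5.53 and Cor. 5.54 (pp. 139–140)] -/
theorem geometricallyConnected_iff_of_isPullback_specMap_ofHom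
    (H : IsPullback q g' g (Spec.map (CommRingCat.ofHom φ))) :
    GeometricallyConnected g' ↔ GeometricallyConnected g := by
  constructor
  · intro h
    have e : pullback.snd g (Spec.map (CommRingCat.ofHom φ)) = H.isoPullback.inv ≫ g' :=
      (H.isoPullback_inv_snd).symm
    have h' : GeometricallyConnected (pullback.snd g (Spec.map (CommRingCat.ofHom φ))) := by
      rw [e]
      exact MorphismProperty.RespectsIso.precomp @GeometricallyConnected _ _ h
    exact SteinFibre.geometricallyConnected_of_geometricallyConnected_baseChange g φ h'
  · intro h
    exact MorphismProperty.of_isPullback H h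

/-- **Geometrically connected ⇔ connected base change to every geometric point** ([GortzWedhorn2020] Prop. 5.53 /
Cor. 5.54: over a field, geometric connectedness may be tested over algebraically closed extensions), for a morphism
to an ARBITRARY base `Y`: `f` is geometrically connected iff `X ×_Y Spec Ω` is connected for every field-valued point
`Spec Ω → Y` with `Ω` algebraically closed. [cite: GortzWedhorn2020, Prop. 5.53 and Cor. 5.54 (pp. 139–140)] -/
theorem geometricallyConnected_iff_forall_isAlgClosed {X Y : Scheme.{u}} (f : X ⟶ Y) :
    GeometricallyConnected f ↔ ∀ (Ω : Type u) [Field Ω] [IsAlgClosed Ω] (y : Spec (.of Ω) ⟶ Y),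
      ConnectedSpace ↥(pullback f y) := by
  constructor
  · intro h Ω _ _ y
    exact pullback_of_geometrically h.geometrically_connectedSpace Ω y
  · intro h
    refine ⟨(geometrically_iff_of_isClosedUnderIsomorphisms (P := fun X : Scheme.{u} ↦ ConnectedSpace X)).mpr
      fun K _ y ↦ ?_⟩
    set y' : Spec (.of (AlgebraicClosure K)) ⟶ Spec (.of K) :=
      Spec.map (CommRingCat.ofHom (algebraMap K (AlgebraicClosure K)))
    -- `X ×_Y Spec K̄ = (X ×_Y Spec K) ×_K Spec K̄ → X ×_Y Spec K` is surjective with connected source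
    haveI : ConnectedSpace ↥(pullback f (y' ≫ y)) := h (AlgebraicClosure K) (y' ≫ y)
    haveI : ConnectedSpace ↥(pullback (pullback.snd f y) y') :=
      (Scheme.homeoOfIso (pullbackLeftPullbackSndIso f y y')).symm.surjective.connectedSpace
        (Scheme.homeoOfIso (pullbackLeftPullbackSndIso f y y')).symm.continuous
    haveI : Surjective y' := surjective_specMap_ofHom_field (algebraMap K (AlgebraicClosure K))
    exact (pullback.fst (pullback.snd f y) y').surjective.connectedSpace
      (pullback.fst (pullback.snd f y) y').continuous

end FieldExtension

section FibreOfBaseChange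

variable {W X Y Z : Scheme.{u}} {fst : W ⟶ X} {snd : W ⟶ Y} {f : X ⟶ Z} {g : Y ⟶ Z}

/-- **Fibre properties of a base change are read at the image point**: for a cartesian square `W = X ×_Z Y`
(`h : IsPullback fst snd f g`) and `y ∈ Y`, the fibre `W_y → Spec κ(y)` of `snd` is the base change of the fibre
`X_{g y} → Spec κ(g y)` of `f` along the field extension `κ(g y) → κ(y)` (Mathlib
`isPullback_fiberToSpecResidueField_of_isPullback`); so for `P` stable under base change and descending along fpqc
covers, `P (W_y → Spec κ(y)) ↔ P (X_{g y} → Spec κ(g y))`. [cite: EGAIV4, Prop. 17.7.4] [cite: StacksProject, Tag 02VL] -/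
theorem iff_fiberToSpecResidueField_of_isPullback (P : MorphismProperty Scheme.{u}) [P.IsStableUnderBaseChange]
    [P.DescendsAlong (@Surjective ⊓ @Flat ⊓ @QuasiCompact)] (h : IsPullback fst snd f g) (y : Y) :
    P (snd.fiberToSpecResidueField y) ↔ P (f.fiberToSpecResidueField (g y)) :=
  iff_of_isPullback_specMap_ofHom (k := Z.residueField (g y)) (l := Y.residueField y)
    (g.residueFieldMap y).hom P (isPullback_fiberToSpecResidueField_of_isPullback h y)

/-- The fibre of a base change at `y` is smooth iff the fibre of the original morphism at the image point `g y` is.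
[cite: EGAIV4, Prop. 17.7.4] [cite: StacksProject, Tag 02VL] -/
theorem smooth_fiberToSpecResidueField_iff_of_isPullback (h : IsPullback fst snd f g) (y : Y) :
    Smooth (snd.fiberToSpecResidueField y) ↔ Smooth (f.fiberToSpecResidueField (g y)) :=
  iff_fiberToSpecResidueField_of_isPullback @Smooth h y

/-- The fibre of a base change at `y` is geometrically connected iff the fibre of the original morphism at the image
point `g y` is. [cite: GortzWedhorn2020, Prop. 5.53 and Cor. 5.54 (pp. 139–140)] -/
theorem geometricallyConnected_fiberToSpecResidueField_iff_of_isPullback (h : IsPullback fst snd f g) (y : Y) :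
    GeometricallyConnected (snd.fiberToSpecResidueField y) ↔
      GeometricallyConnected (f.fiberToSpecResidueField (g y)) :=
  geometricallyConnected_iff_of_isPullback_specMap_ofHom (k := Z.residueField (g y)) (l := Y.residueField y)
    (g.residueFieldMap y).hom (isPullback_fiberToSpecResidueField_of_isPullback h y)

/-! ## §2 The range criterion: `g(T) ⊆ U₁(f)` iff the base change of `f` along `g` is smooth with geometrically
connected fibres -/

/-- **Range criterion, fibrewise form** (no properness, no flatness): for a cartesian square `W = X ×_Z Y`, the image
of `g` lies in `U₁(f) = {z | X_z smooth and geometrically connected}` iff every fibre of `W → Y` is smooth and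
geometrically connected. [cite: MumfordFogartyKirwan1994, Ch. 7 §2, Prop. 7.3, proof, step (I) (pp. 132–133)] -/
theorem range_subset_setOf_iff_forall_fiber (h : IsPullback fst snd f g) :
    Set.range g ⊆ {z : Z | Smooth (f.fiberToSpecResidueField z) ∧
        GeometricallyConnected (f.fiberToSpecResidueField z)} ↔
      ∀ y, Smooth (snd.fiberToSpecResidueField y) ∧ GeometricallyConnected (snd.fiberToSpecResidueField y) := by
  rw [Set.range_subset_iff]
  refine forall_congr' fun y => ?_
  rw [Set.mem_setOf_eq, smooth_fiberToSpecResidueField_iff_of_isPullback h y,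
    geometricallyConnected_fiberToSpecResidueField_iff_of_isPullback h y]

/-- For a flat morphism locally of finite presentation, smoothness is fibrewise ([EGAIV4] Thm. 17.5.1, Mathlib
`Smooth.of_smooth_fiberToSpecResidueField`), and so is geometric connectedness (Mathlib
`GeometricallyConnected.iff_geometricallyConnected_fiber`); both transported to the base change `snd` of `f`.
[cite: EGAIV4, Thm. 17.5.1] [cite: StacksProject, Tag 01V8] -/
theorem smooth_and_geometricallyConnected_iff_forall_fiber [LocallyOfFinitePresentation f] [Flat f]
    (h : IsPullback fst snd f g) :
    (Smooth snd ∧ GeometricallyConnected snd) ↔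
      ∀ y, Smooth (snd.fiberToSpecResidueField y) ∧ GeometricallyConnected (snd.fiberToSpecResidueField y) := by
  haveI : Flat snd := MorphismProperty.of_isPullback h inferInstance
  haveI : LocallyOfFinitePresentation snd := MorphismProperty.of_isPullback h inferInstance
  rw [forall_and, GeometricallyConnected.iff_geometricallyConnected_fiber]
  refine and_congr_left fun _ => ⟨fun hs y => ?_, fun hs => Smooth.of_smooth_fiberToSpecResidueField snd hs⟩
  exact MorphismProperty.of_isPullback (P := @Smooth)
    (IsPullback.of_hasPullback snd (Y.fromSpecResidueField y)) hs

/-- **Range criterion** ([MumfordFogartyKirwan1994] Prop. 7.3, proof, step (I), «`U₁` is a subfunctor … represented by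
an open subset»): for `f : X → Z` flat and locally of finite presentation and a cartesian square `W = X ×_Z Y` along
`g : Y → Z`, the image of `g` lies in `U₁(f)` iff `W → Y` is smooth and geometrically connected.
[cite: MumfordFogartyKirwan1994, Ch. 7 §2, Prop. 7.3, proof, step (I) (pp. 132–133)] [cite: EGAIV4, Thm. 17.5.1] -/
theorem range_subset_setOf_iff_smooth_and_geometricallyConnected [LocallyOfFinitePresentation f] [Flat f]
    (h : IsPullback fst snd f g) :
    Set.range g ⊆ {z : Z | Smooth (f.fiberToSpecResidueField z) ∧
        GeometricallyConnected (f.fiberToSpecResidueField z)} ↔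
      Smooth snd ∧ GeometricallyConnected snd := by
  rw [range_subset_setOf_iff_forall_fiber h, smooth_and_geometricallyConnected_iff_forall_fiber h]

/-- **Range criterion, geometric-points form** (MFK's wording «smooth with connected geometric fibres»): for `f` flat
and locally of finite presentation and a cartesian square `W = X ×_Z Y`, the image of `g` lies in `U₁(f)` iff for every
geometric point `x : Spec Ω → Y` (`Ω` algebraically closed) the base change `W ×_Y Spec Ω → Spec Ω` is smooth and
`W ×_Y Spec Ω` is connected. [cite: MumfordFogartyKirwan1994, Ch. 7 §2, Prop. 7.3, proof, step (I) (pp. 132–133)]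
[cite: GortzWedhorn2020, Prop. 5.53 and Cor. 5.54 (pp. 139–140)] -/
theorem range_subset_setOf_iff_forall_isAlgClosed [LocallyOfFinitePresentation f] [Flat f]
    (h : IsPullback fst snd f g) :
    Set.range g ⊆ {z : Z | Smooth (f.fiberToSpecResidueField z) ∧
        GeometricallyConnected (f.fiberToSpecResidueField z)} ↔
      ∀ (Ω : Type u) [Field Ω] [IsAlgClosed Ω] (x : Spec (.of Ω) ⟶ Y),
        Smooth (pullback.snd snd x) ∧ ConnectedSpace ↥(pullback snd x) := by
  rw [range_subset_setOf_iff_smooth_and_geometricallyConnected h]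
  constructor
  · rintro ⟨hs, hc⟩ Ω _ _ x
    exact ⟨inferInstance, pullback_of_geometrically hc.geometrically_connectedSpace Ω x⟩
  · intro H
    haveI : Flat snd := MorphismProperty.of_isPullback h inferInstance
    haveI : LocallyOfFinitePresentation snd := MorphismProperty.of_isPullback h inferInstance
    -- smoothness: test at the geometric point over each `y`, then descend along `κ(y) → κ(y)‾`
    refine ⟨Smooth.of_smooth_fiberToSpecResidueField snd fun y => ?_,
      (geometricallyConnected_iff_forall_isAlgClosed snd).2 fun Ω _ _ x => (H Ω x).2⟩
    set ι : Y.residueField y →+* AlgebraicClosure (Y.residueField y) :=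
      algebraMap (Y.residueField y) (AlgebraicClosure (Y.residueField y))
    set y' : Spec (.of (AlgebraicClosure (Y.residueField y))) ⟶ Spec (Y.residueField y) :=
      Spec.map (CommRingCat.ofHom ι)
    have hx := (H (AlgebraicClosure (Y.residueField y)) (y' ≫ Y.fromSpecResidueField y)).1
    -- `W ×_Y Spec κ(y)‾ = W_y ⊗_{κ(y)} κ(y)‾`
    have e : pullback.snd (snd.fiberToSpecResidueField y) y' =
        (pullbackLeftPullbackSndIso snd (Y.fromSpecResidueField y) y').hom ≫
          pullback.snd snd (y' ≫ Y.fromSpecResidueField y) :=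
      (pullbackLeftPullbackSndIso_hom_snd snd (Y.fromSpecResidueField y) y').symm
    have hs' : Smooth (pullback.snd (snd.fiberToSpecResidueField y) y') := by
      rw [e]; infer_instance
    exact (smooth_iff_of_isPullback_specMap_ofHom ι
      (IsPullback.of_hasPullback (snd.fiberToSpecResidueField y) y')).1 hs'

/-- **Universal property of an open with carrier `U₁(f)`** ([GortzWedhorn2020] Thm. 8.9: open subfunctors are
represented by open subschemes): if `U ⊆ Z` is open with underlying set `U₁(f)`, then for `f` flat and locally of finite
presentation and every cartesian square `W = X ×_Z Y` along `g : Y → Z`, `g` factors (uniquely) through `U ↪ Z` iff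
`W → Y` is smooth and geometrically connected. [cite: GortzWedhorn2020, Thm. 8.9 (p. 212)]
[cite: MumfordFogartyKirwan1994, Ch. 7 §2, Prop. 7.3, proof, step (I) (pp. 132–133)] -/
theorem existsUnique_comp_ι_iff_smooth_and_geometricallyConnected [LocallyOfFinitePresentation f] [Flat f]
    (U : Z.Opens) (hU : (U : Set Z) = {z : Z | Smooth (f.fiberToSpecResidueField z) ∧
      GeometricallyConnected (f.fiberToSpecResidueField z)}) (h : IsPullback fst snd f g) :
    (∃! g' : Y ⟶ (U : Scheme.{u}), g' ≫ U.ι = g) ↔ Smooth snd ∧ GeometricallyConnected snd := by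
  rw [Motives.existsUnique_comp_opensι_eq_iff_range_subset, hU,
    range_subset_setOf_iff_smooth_and_geometricallyConnected h]

/-- Fibrewise variant of `existsUnique_comp_ι_iff_smooth_and_geometricallyConnected` (no flatness needed): `g` factors
through the open `U` with carrier `U₁(f)` iff every fibre of `W → Y` is smooth and geometrically connected.
[cite: GortzWedhorn2020, Thm. 8.9 (p. 212)] -/
theorem existsUnique_comp_ι_iff_forall_fiber (U : Z.Opens)
    (hU : (U : Set Z) = {z : Z | Smooth (f.fiberToSpecResidueField z) ∧
      GeometricallyConnected (f.fiberToSpecResidueField z)}) (h : IsPullback fst snd f g) :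
    (∃! g' : Y ⟶ (U : Scheme.{u}), g' ≫ U.ι = g) ↔
      ∀ y, Smooth (snd.fiberToSpecResidueField y) ∧ GeometricallyConnected (snd.fiberToSpecResidueField y) := by
  rw [Motives.existsUnique_comp_opensι_eq_iff_range_subset, hU, range_subset_setOf_iff_forall_fiber h]

end FibreOfBaseChange

/-! ## §3 MFK Prop. 7.3, step (I): the open subscheme `U₁ ↪ S` represents «smooth with geometrically connected fibres» -/

section Locus

variable {X S : Scheme.{0}} (p : X ⟶ S) [IsProper p] [Flat p] [IsLocallyNoetherian S]

/-- **THE LOCUS OF SMOOTH GEOMETRICALLY CONNECTED FIBRES REPRESENTS ITS FUNCTOR** ([MumfordFogartyKirwan1994] Prop. 7.3,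
proof, step (I)): for `p : X → S` proper and flat over a locally noetherian `S` there is an open `U ⊆ S` with underlying
set `{s | X_s → Spec κ(s) smooth and geometrically connected}` (★ `isOpen_setOf_smooth_and_geometricallyConnected_fiber`)
such that for every `g : T → S` and every cartesian square `X_T → T` of `p` along `g`, `g` factors (uniquely) through
`U ↪ S` iff `X_T → T` is smooth and geometrically connected.
[cite: MumfordFogartyKirwan1994, Ch. 7 §2, Prop. 7.3, proof, step (I) (pp. 132–133)] [cite: GortzWedhorn2020, Thm. 8.9 (p. 212)] -/
theorem exists_opens_forall_existsUnique_comp_ι_iff_smooth_and_geometricallyConnected :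
    ∃ U : S.Opens, (U : Set S) = {s : S | Smooth (p.fiberToSpecResidueField s) ∧
        GeometricallyConnected (p.fiberToSpecResidueField s)} ∧
      ∀ {T XT : Scheme.{0}} (g : T ⟶ S) {pr : XT ⟶ X} {pT : XT ⟶ T} (_ : IsPullback pr pT p g),
        (∃! g' : T ⟶ (U : Scheme.{0}), g' ≫ U.ι = g) ↔ Smooth pT ∧ GeometricallyConnected pT :=
  ⟨⟨_, isOpen_setOf_smooth_and_geometricallyConnected_fiber p⟩, rfl, fun _ _ _ H =>
    existsUnique_comp_ι_iff_smooth_and_geometricallyConnected _ rfl H⟩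

/-- Fibrewise form of the universal property of `U₁ ↪ S`: `g : T → S` factors through `U₁` iff every fibre of
`X_T → T` is smooth and geometrically connected. [cite: MumfordFogartyKirwan1994, Ch. 7 §2, Prop. 7.3, proof, step (I) (pp. 132–133)] -/
theorem exists_opens_forall_existsUnique_comp_ι_iff_forall_fiber :
    ∃ U : S.Opens, (U : Set S) = {s : S | Smooth (p.fiberToSpecResidueField s) ∧
        GeometricallyConnected (p.fiberToSpecResidueField s)} ∧
      ∀ {T XT : Scheme.{0}} (g : T ⟶ S) {pr : XT ⟶ X} {pT : XT ⟶ T} (_ : IsPullback pr pT p g),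
        (∃! g' : T ⟶ (U : Scheme.{0}), g' ≫ U.ι = g) ↔
          ∀ t, Smooth (pT.fiberToSpecResidueField t) ∧ GeometricallyConnected (pT.fiberToSpecResidueField t) :=
  ⟨⟨_, isOpen_setOf_smooth_and_geometricallyConnected_fiber p⟩, rfl, fun _ _ _ H =>
    existsUnique_comp_ι_iff_forall_fiber _ rfl H⟩

/-- Geometric-points form of the universal property of `U₁ ↪ S` (MFK's wording): `g : T → S` factors through `U₁` iff
for every geometric point `x : Spec Ω → T` the base change `X_T ×_T Spec Ω → Spec Ω` is smooth with connected source.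
[cite: MumfordFogartyKirwan1994, Ch. 7 §2, Prop. 7.3, proof, step (I) (pp. 132–133)]
[cite: GortzWedhorn2020, Prop. 5.53 and Cor. 5.54 (pp. 139–140)] -/
theorem exists_opens_forall_existsUnique_comp_ι_iff_forall_isAlgClosed :
    ∃ U : S.Opens, (U : Set S) = {s : S | Smooth (p.fiberToSpecResidueField s) ∧
        GeometricallyConnected (p.fiberToSpecResidueField s)} ∧
      ∀ {T XT : Scheme.{0}} (g : T ⟶ S) {pr : XT ⟶ X} {pT : XT ⟶ T} (_ : IsPullback pr pT p g),
        (∃! g' : T ⟶ (U : Scheme.{0}), g' ≫ U.ι = g) ↔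
          ∀ (Ω : Type) [Field Ω] [IsAlgClosed Ω] (x : Spec (.of Ω) ⟶ T),
            Smooth (pullback.snd pT x) ∧ ConnectedSpace ↥(pullback pT x) := by
  haveI : LocallyOfFinitePresentation p := inferInstance
  refine ⟨⟨_, isOpen_setOf_smooth_and_geometricallyConnected_fiber p⟩, rfl, fun g _ _ H => ?_⟩
  rw [Motives.existsUnique_comp_opensι_eq_iff_range_subset]
  exact range_subset_setOf_iff_forall_isAlgClosed H

/-- **The (γ)-shape of the F-6 locus tower, step (I)**: there is an OPEN IMMERSION `j : H → S` with range
`{s | X_s smooth and geometrically connected}` such that a morphism `g : T → S` factors (uniquely) through `j` iff the base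
change `X_T → T` of `p` along `g` is smooth and geometrically connected.
[cite: MumfordFogartyKirwan1994, Ch. 7 §2, Prop. 7.3, proof, step (I) (pp. 132–133)] [cite: GortzWedhorn2020, Thm. 8.9 (p. 212)] -/
theorem exists_isOpenImmersion_forall_existsUnique_comp_eq_iff_smooth_and_geometricallyConnected :
    ∃ (H : Scheme.{0}) (j : H ⟶ S), IsOpenImmersion j ∧
      Set.range j = {s : S | Smooth (p.fiberToSpecResidueField s) ∧
        GeometricallyConnected (p.fiberToSpecResidueField s)} ∧
      ∀ {T XT : Scheme.{0}} (g : T ⟶ S) {pr : XT ⟶ X} {pT : XT ⟶ T} (_ : IsPullback pr pT p g),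
        (∃! v : T ⟶ H, v ≫ j = g) ↔ Smooth pT ∧ GeometricallyConnected pT := by
  obtain ⟨U, hU, h⟩ := exists_opens_forall_existsUnique_comp_ι_iff_smooth_and_geometricallyConnected p
  exact ⟨U, U.ι, inferInstance, by rw [Scheme.Opens.range_ι]; exact hU, fun g _ _ H => h g H⟩

/-- Canonical-pullback form: with `X_T := pullback p g → T` the chosen pullback, `g : T → S` factors (uniquely) through
the open immersion `j` of step (I) iff `pullback.snd p g` is smooth and geometrically connected.
[cite: MumfordFogartyKirwan1994, Ch. 7 §2, Prop. 7.3, proof, step (I) (pp. 132–133)] -/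
theorem exists_isOpenImmersion_forall_existsUnique_comp_eq_iff_pullback_snd :
    ∃ (H : Scheme.{0}) (j : H ⟶ S), IsOpenImmersion j ∧
      Set.range j = {s : S | Smooth (p.fiberToSpecResidueField s) ∧
        GeometricallyConnected (p.fiberToSpecResidueField s)} ∧
      ∀ {T : Scheme.{0}} (g : T ⟶ S),
        (∃! v : T ⟶ H, v ≫ j = g) ↔ Smooth (pullback.snd p g) ∧ GeometricallyConnected (pullback.snd p g) := by
  obtain ⟨H, j, hj, hr, h⟩ := exists_isOpenImmersion_forall_existsUnique_comp_eq_iff_smooth_and_geometricallyConnected p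
  exact ⟨H, j, hj, hr, fun g => h g (IsPullback.of_hasPullback p g)⟩

end Locus

end Literature.AlgebraicGeometry.Morphisms

end
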